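import Summits.Ventures.PercRepro.S1ChainSkewCap

/-!
# PercRepro — THE FOUR-CIRCUITS THROUGH TWO POINTS: THE PLANE DOUBLE COUNT (p2, gen 24; SUBCLAIM-S1 §6.9 (vii) step 5)

Two points `x ≠ y` and a finite part `U` of the ground set not containing them. A four-circuit `{x, y, c, c'}` with
`c, c' ∈ U` puts `c'` in the plane `cl{x, y, c}` (a circuit's point lies in the closure of the rest), which has at
most six points under (C2) — so every `c ∈ U` lies in at most three such circuits, while every such circuit
contains exactly two points of `U`: by double counting, `2·#{circuits} ≤ 3·|U|` — at most `⌊3|U|/2⌋` four-circuits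
through `x` and `y` with their other points in `U` (`22` at `|U| = 15`; the sharp plane-class count gives `21`).
With the one-point cap `s₄(z) ≤ 3` this bounds the four-circuits of the five-skew-triangle lines of `(10, 7)` by
`3 + 3 + 22 = 28` against the need `29` (S1 v62 §6.9 (vii)).

* `ncard_closure_triple_diff_le_three` — the other points of the plane through three points: `≤ 3`;
* **`two_mul_ncard_fourCircuits_through_pair_le`** — the double count.
Axioms: standard.
-/

open scoped Matroid

namespace PercRepro

namespace S1

open Set

variable {α : Type}

/-- Under (C2) the plane through three points of the ground set holds at most three further points. -/
theorem ncard_closure_triple_diff_le_three (M : Matroid α) [M.Finite]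
    (hplane : ∀ P ⊆ M.E, M.eRk P ≤ 3 → P.ncard ≤ 6) {x y c : α} (hx : x ∈ M.E) (hy : y ∈ M.E) (hc : c ∈ M.E)
    (hxy : x ≠ y) (hxc : x ≠ c) (hyc : y ≠ c) :
    (M.closure {x, y, c} \ {x, y, c}).ncard ≤ 3 := by
  have hsub : ({x, y, c} : Set α) ⊆ M.E := by
    intro w hw
    simp only [Set.mem_insert_iff, Set.mem_singleton_iff] at hw
    rcases hw with rfl | rfl | rfl <;> assumption
  have hPE : M.closure {x, y, c} ⊆ M.E := M.closure_subset_ground _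
  have hPfin : (M.closure {x, y, c}).Finite := M.ground_finite.subset hPE
  have hrk : M.eRk (M.closure {x, y, c}) ≤ 3 := by
    rw [M.eRk_closure_eq]
    calc M.eRk {x, y, c} ≤ ({x, y, c} : Set α).encard := M.eRk_le_encard _
      _ ≤ 3 := by
          rw [Set.encard_insert_of_notMem, Set.encard_pair hyc]
          · norm_num
          · simp only [Set.mem_insert_iff, Set.mem_singleton_iff, not_or]
            exact ⟨hxy, hxc⟩
  have h6 := hplane _ hPE hrk
  have h3 : ({x, y, c} : Set α).ncard = 3 := by
    rw [Set.ncard_insert_of_notMem (by simp only [Set.mem_insert_iff, Set.mem_singleton_iff, not_or]; exact ⟨hxy, hxc⟩)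
      (Set.toFinite _), Set.ncard_pair hyc]
  have hsubP : ({x, y, c} : Set α) ⊆ M.closure {x, y, c} := M.subset_closure _ hsub
  have := Set.ncard_sdiff_add_ncard_of_subset hsubP hPfin
  omega

/-- **THE DOUBLE COUNT**: `2·#{four-circuits C ∋ x, y with C ⊆ U ∪ {x, y}} ≤ 3·|U|` for `x ≠ y` outside the
finite part `U ⊆ E` — every such circuit has two points in `U`, every point of `U` lies in at most three (its
partner is one of the `≤ 3` further points of the plane through `x`, `y` and it). -/
theorem two_mul_ncard_fourCircuits_through_pair_le (M : Matroid α) [M.Finite]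
    (hplane : ∀ P ⊆ M.E, M.eRk P ≤ 3 → P.ncard ≤ 6) {U : Set α} (hU : U ⊆ M.E)
    {x y : α} (hx : x ∈ M.E) (hy : y ∈ M.E) (hxy : x ≠ y) (hxU : x ∉ U) (hyU : y ∉ U) :
    2 * {C : Set α | M.IsCircuit C ∧ C.ncard = 4 ∧ x ∈ C ∧ y ∈ C ∧ C ⊆ U ∪ {x, y}}.ncard ≤ 3 * U.ncard := by
  classical
  have hUfin : U.Finite := M.ground_finite.subset hU
  set 𝒞 := {C : Set α | M.IsCircuit C ∧ C.ncard = 4 ∧ x ∈ C ∧ y ∈ C ∧ C ⊆ U ∪ {x, y}} with h𝒞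
  have h𝒞fin : 𝒞.Finite :=
    (hUfin.union (Set.toFinite {x, y})).finite_subsets.subset (fun C hC => hC.2.2.2.2)
  set 𝒞f := h𝒞fin.toFinset with h𝒞f
  set Uf := hUfin.toFinset with hUf
  have hmem𝒞 : ∀ C, C ∈ 𝒞f ↔ C ∈ 𝒞 := fun C => Set.Finite.mem_toFinset h𝒞fin
  have hmemU : ∀ c, c ∈ Uf ↔ c ∈ U := fun c => Set.Finite.mem_toFinset hUfin
  -- the relation: `c ∈ C`
  have key := Finset.card_mul_le_card_mul (fun (C : Set α) (c : α) => c ∈ C) (s := 𝒞f) (t := Uf) (m := 2) (n := 3)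
    ?_ ?_
  · rw [Set.ncard_eq_toFinset_card _ h𝒞fin, Set.ncard_eq_toFinset_card _ hUfin]
    rw [mul_comm 2, mul_comm 3]
    exact key
  · -- every circuit holds exactly two points of `U`
    intro C hC
    rw [hmem𝒞] at hC
    obtain ⟨hcirc, h4, hxC, hyC, hsub⟩ := hC
    have hCfin : C.Finite := M.ground_finite.subset hcirc.subset_ground
    have hsplit : (C ∩ U).ncard + 2 = 4 := by
      have e : C = (C ∩ U) ∪ {x, y} := by
        ext w; constructor
        · intro hw
          rcases hsub hw with h | h
          · exact Or.inl ⟨hw, h⟩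
          · exact Or.inr h
        · rintro (⟨hw, -⟩ | hw)
          · exact hw
          · simp only [Set.mem_insert_iff, Set.mem_singleton_iff] at hw
            rcases hw with rfl | rfl <;> assumption
      have hd : Disjoint (C ∩ U) {x, y} := by
        rw [Set.disjoint_left]
        rintro w ⟨-, hwU⟩ hw
        simp only [Set.mem_insert_iff, Set.mem_singleton_iff] at hw
        rcases hw with rfl | rfl
        · exact hxU hwU
        · exact hyU hwU
      have := Set.ncard_union_eq hd (hCfin.subset Set.inter_subset_left) (Set.toFinite _)
      rw [← e, h4, Set.ncard_pair hxy] at this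
      omega
    have hcard : (Uf.bipartiteAbove (fun (C : Set α) (c : α) => c ∈ C) C).card = (C ∩ U).ncard := by
      rw [Set.ncard_eq_toFinset_card _ (hCfin.subset Set.inter_subset_left)]
      congr 1
      ext c
      simp only [Finset.bipartiteAbove, Finset.mem_filter, hmemU, Set.Finite.mem_toFinset, Set.mem_inter_iff]
      tauto
    rw [hcard]
    omega
  · -- every point of `U` lies in at most three circuits
    intro c hc
    rw [hmemU] at hc
    have hcE : c ∈ M.E := hU hc
    have hxc : x ≠ c := fun h => hxU (h ▸ hc)
    have hyc : y ≠ c := fun h => hyU (h ▸ hc)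
    -- the partner of `c` in a circuit is a further point of the plane through `x, y, c`
    set W := M.closure {x, y, c} \ {x, y, c} with hW
    have hWfin : W.Finite := (M.ground_finite.subset (M.closure_subset_ground _)).subset Set.sdiff_subset
    have hW3 := ncard_closure_triple_diff_le_three M hplane hx hy hcE hxy hxc hyc
    have hinj : ∀ C ∈ 𝒞f.bipartiteBelow (fun (C : Set α) (c : α) => c ∈ C) c,
        ∃ c' ∈ W, C = {x, y, c, c'} := by
      intro C hC
      simp only [Finset.bipartiteBelow, Finset.mem_filter, hmem𝒞] at hC
      obtain ⟨⟨hcirc, h4, hxC, hyC, hsub⟩, hcC⟩ := hC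
      have hCfin : C.Finite := M.ground_finite.subset hcirc.subset_ground
      have hsub3 : ({x, y, c} : Set α) ⊆ C := by
        intro w hw
        simp only [Set.mem_insert_iff, Set.mem_singleton_iff] at hw
        rcases hw with rfl | rfl | rfl <;> assumption
      have h3 : ({x, y, c} : Set α).ncard = 3 := by
        rw [Set.ncard_insert_of_notMem (by simp only [Set.mem_insert_iff, Set.mem_singleton_iff, not_or]; exact ⟨hxy, hxc⟩)
          (Set.toFinite _), Set.ncard_pair hyc]
      have hrest : (C \ {x, y, c}).ncard = 1 := by
        have := Set.ncard_sdiff_add_ncard_of_subset hsub3 hCfin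
        omega
      obtain ⟨c', hc'⟩ := Set.ncard_eq_one.1 hrest
      have hc'C : c' ∈ C := ((Set.ext_iff.1 hc' c').2 rfl).1
      have hc'3 : c' ∉ ({x, y, c} : Set α) := ((Set.ext_iff.1 hc' c').2 rfl).2
      refine ⟨c', ⟨?_, hc'3⟩, ?_⟩
      · have h := hcirc.mem_closure_sdiff_singleton_of_mem hc'C
        have e : C \ {c'} = {x, y, c} := by
          ext w; simp only [Set.mem_sdiff, Set.mem_singleton_iff]
          constructor
          · rintro ⟨hwC, hwc'⟩
            by_contra hw3
            have : w ∈ C \ {x, y, c} := ⟨hwC, hw3⟩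
            rw [hc'] at this
            exact hwc' this
          · intro hw
            exact ⟨hsub3 hw, fun h' => hc'3 (h' ▸ hw)⟩
        rwa [e] at h
      · ext w; constructor
        · intro hw
          by_cases hw3 : w ∈ ({x, y, c} : Set α)
          · simp only [Set.mem_insert_iff, Set.mem_singleton_iff] at hw3 ⊢
            rcases hw3 with rfl | rfl | rfl <;> simp
          · have : w ∈ C \ {x, y, c} := ⟨hw, hw3⟩
            rw [hc'] at this
            rw [Set.mem_singleton_iff.1 this]
            simp
        · intro hw
          simp only [Set.mem_insert_iff, Set.mem_singleton_iff] at hw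
          rcases hw with rfl | rfl | rfl | rfl
          · exact hxC
          · exact hyC
          · exact hcC
          · exact hc'C
    -- the injection `C ↦ c'` into `W`
    have hle : (𝒞f.bipartiteBelow (fun (C : Set α) (c : α) => c ∈ C) c).card ≤ W.ncard := by
      rw [Set.ncard_eq_toFinset_card _ hWfin]
      refine Finset.card_le_card_of_injOn (fun C => if h : ∃ c' ∈ W, C = {x, y, c, c'} then h.choose else x) ?_ ?_
      · intro C hC
        have h := hinj C hC
        simp only [dif_pos h]
        rw [Finset.mem_coe, Set.Finite.mem_toFinset]
        exact h.choose_spec.1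
      · intro C hC C' hC' heq
        have h := hinj C (Finset.mem_coe.1 hC)
        have h' := hinj C' (Finset.mem_coe.1 hC')
        simp only [dif_pos h, dif_pos h'] at heq
        rw [h.choose_spec.2, h'.choose_spec.2, heq]
    have hW3' : W.ncard ≤ 3 := hW3
    omega

end S1

end PercRepro
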